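import Summits.BirchSwinnertonDyer.Rank1Residual.SmallImageMu.HeightLValueMatchCriteria
import Summits.BirchSwinnertonDyer.Rank1Residual.SmallImageMu.KatoDivisibility
import HarnessLib
import HarnessLib.Audit

/-!
# Kernel glue of the regular-prime / MATCH criteria: the two Ш-gates agree; C7′ ⟹ C7 and (with GZK) C6;
# each certified X9 pair satisfies the crux AT THE PAIR (BC5-rung shape); the criteria reduce the node
# `KatoDivisibilityOnClassX9` to the uncertified X9 pairs

HONEST FRAMING (cell `bsd-f3-mu`).  THEOREMS ONLY, sorry-free; CONDITIONAL, credits nothing.  Per-pair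
rungs: an X9 pair that is REGULAR (`Rank1Residual.RegularPrimeAt`), resp. carries MATCH
(`Rank1Residual.HeightLValueMatchAt`) with the Ш-gate `p ∤ #Ш(E)[p^∞]` — equivalently (§1) a `p`-descent
certifying `Ш(E/ℚ)[p] = 0` (`Rank1Residual.ShaPTorsionFreeAt`) — satisfies Kato's integral divisibility
`KatoDivisibilityAt W p` AT THE PAIR, granted Perrin-Riou–Schneider (`hS`), the canonical-height facts
(`hex`), BCS 2025 Thm. 1.1.2 (a) (`hBCS`) and modularity (`hmodP`), all published and by name — NO analytic
`μ = 0` certificate, NO class group, NO first layer, NO image input beyond `E[p]` irreducible (the per-pair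
theorems are the Literature ones, `Rank1Residual.RegularPrimeAt.katoDivisibilityAt`,
`Rank1Residual.HeightLValueMatchAt.katoDivisibilityAt(_of_shaPTorsionFreeAt)`).  The class-wide «cover»
engines take as DATA the disjunction «certified on this road, or Kato divisibility holds at the pair
otherwise» (`hcover`): the literal shape in which the candidates REDUCE the node to the uncertified pairs
(censuses REGULAR-CENSUS-v1 / DESCENT-CENSUS-v1: crux per pair F1-free on 756 of 790 X9 rows, GRH-flagged
where so).  Ported from `HOME/desc/Sketch7.lean` §3–§4, §6–§7 (sha16 433aa2f37f3eda0d, rc 0; REF1-AUDIT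
§3.7/§3.9: glue kernel-proved mod cites) onto the filed names; §1 is new kernel bookkeeping.

References: [SteinWuthrich2013] §6.1 Thm. 6.1 (p. 20), §8; [BurungaleCastellaSkinner2025] Thm. 1.1.2 (a);
[GreenbergVatsal2000] Prop. 3.7; [Miller2011LMS] Def. 1.1, §6–§7; HOME MEMO-desc.md §12–§13.
-/

-- the summit and its single problem are both named `BirchSwinnertonDyer` (registry layout D-0017)
set_option linter.dupNamespace false

noncomputable section

open scoped Classical MatrixGroups ModularForm

open CongruenceSubgroup WeierstrassCurve Literature.NumberTheory.EllipticCurves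
  Literature.NumberTheory.EllipticCurves.ModularForms
  Literature.NumberTheory.EllipticCurves.BurungaleCastellaSkinner2025
  Summit.BirchSwinnertonDyer.BirchSwinnertonDyer.Rank1Residual
open Literature.NumberTheory.EllipticCurves.Rank1Residual (RegularPrimeAt HeightLValueMatchAt
  ShaPTorsionFreeAt HasLambdaAnAt KatoDivisibilityAt
  not_dvd_natCard_primaryComponent_sha_of_shaPTorsionFreeAt)

namespace Summit.BirchSwinnertonDyer.Rank1Residual.SmallImageMu

/-! ## §1 Bookkeeping: the Ш-gate `p ∤ #Ш[p^∞]` is the descent gate `Ш[p] = 0`; C7′ contains C7 and (granted GZK) C6 -/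

section Gates

variable {W : WeierstrassCurve ℚ} [W.IsElliptic] {p : ℕ} [Fact p.Prime]

/-- **`p ∤ #Ш(E)[p^∞] ⟹ Ш(E)[p] = 0`** (the converse of the descent Ш-gate): `¬ p ∣ Nat.card` forces
`Ш[p^∞]` FINITE (an infinite type has `Nat.card = 0`) of order prime to `p`, and a class killed by `p` has
order dividing both `p` and that order (Lagrange), hence order `1`; with
`Rank1Residual.not_dvd_natCard_primaryComponent_sha_of_shaPTorsionFreeAt` the two Ш-gates AGREE. Bookkeeping.
[cite: Miller2011LMS, Def. 1.1 and §6 Example 6.4] -/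
theorem shaPTorsionFreeAt_of_not_dvd_natCard_primaryComponent_sha
    (h : ¬ p ∣ Nat.card (AddCommGroup.primaryComponent W.sha p)) : ShaPTorsionFreeAt W p := by
  intro c hc hpc
  have hpP : p.Prime := Fact.out
  have hx : p • (⟨c, hc⟩ : W.sha) = 0 := Subtype.ext (by simpa using hpc)
  have hmem : (⟨c, hc⟩ : W.sha) ∈ AddCommGroup.primaryComponent W.sha p :=
    (AddCommGroup.mem_primaryComponent).mpr ⟨1, by simpa using hx⟩
  set y : AddCommGroup.primaryComponent W.sha p := ⟨⟨c, hc⟩, hmem⟩ with hy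
  have hy0 : p • y = 0 := Subtype.ext (by simpa [hy] using hx)
  have h1 : addOrderOf y ∣ p := addOrderOf_dvd_of_nsmul_eq_zero hy0
  have h2 : addOrderOf y ∣ Nat.card (AddCommGroup.primaryComponent W.sha p) := addOrderOf_dvd_natCard y
  have hcop : Nat.Coprime p (Nat.card (AddCommGroup.primaryComponent W.sha p)) :=
    (Nat.Prime.coprime_iff_not_dvd hpP).mpr h
  have h3 : addOrderOf y = 1 := by
    have h12 := Nat.dvd_gcd h1 h2
    rw [Nat.Coprime.gcd_eq_one hcop] at h12
    exact Nat.dvd_one.mp h12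
  have hy1 : y = 0 := AddMonoid.addOrderOf_eq_one_iff.mp h3
  have : (⟨c, hc⟩ : W.sha) = 0 := by simpa [hy] using congrArg Subtype.val hy1
  simpa using congrArg Subtype.val this

end Gates

/-- **desc-C7′ contains desc-C7** (Mordell–Weil rank `0 ≤ 1`). [cite: Miller2011LMS, Def. 1.1] -/
theorem matchX9R0_of_descentMatchX9 (hC : DescentMatchX9) : MatchX9R0 :=
  fun W _ _ p _ hX9 hr hdesc => hC W p hX9 (by omega) hdesc

/-- **desc-C7′ with Gross–Zagier–Kolyvagin contains desc-C6**: in analytic rank 1 GZK gives Mordell–Weil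
rank `1 ≤ 1`, and the Ш-gate `p ∤ #Ш[p^∞]` is the descent gate `Ш[p] = 0` (§1).
[cite: Miller2011LMS, Def. 1.1] [cite: SteinWuthrich2013, §6.1 Thm. 6.1 (p. 20)] -/
theorem matchX9R1_of_descentMatchX9 (hGZK : rank_eq_analyticRank_of_analyticRank_le_one)
    (hC : DescentMatchX9) : MatchX9R1 := by
  intro W _ _ p _ hX9 hr hsha
  obtain ⟨hrank, -⟩ := hGZK W (by omega)
  exact hC W p hX9 (by omega) (shaPTorsionFreeAt_of_not_dvd_natCard_primaryComponent_sha hsha)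

/-! ## §2 The BC5-rung shapes: a certified X9 pair satisfies the crux AT THE PAIR -/

section PerPair

variable {W : WeierstrassCurve ℚ} [W.IsElliptic] [W.IsGloballyMinimal] {p : ℕ} [Fact p.Prime]

/-- **A REGULAR X9 pair satisfies the crux `KatoDivisibilityOnClassX9` AT THE PAIR** (PRS, canonical height,
BCS (a), modularity by name; no `μ_an` certificate). [cite: SteinWuthrich2013, §6.1 Thm. 6.1 and the paragraph after it (p. 20)]
[cite: BurungaleCastellaSkinner2025, Thm. 1.1.2 (a)] [cite: GreenbergVatsal2000, Prop. 3.7] -/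
theorem katoDivisibilityAt_of_regularPrimeAt (hS : Schneider1985_order_charGenerator)
    (hex : exists_isCanonical) (hBCS : burungale_castella_skinner_charIdeal_eq_padicLFunction)
    (hmodP : nonempty_modularParametrizationData) (hX9 : ClassX9 W p) (hreg : RegularPrimeAt W p) :
    KatoDivisibilityAt W p := by
  obtain ⟨-, -, -, -, hirr, -⟩ := id hX9
  exact hreg.katoDivisibilityAt hS hex hBCS hmodP hirr

/-- desc-C5 feeds the crux node on its rows (rank 1, `λ_an = 1`). [cite: SteinWuthrich2013, §6.1 (p. 20)] -/
theorem katoDivisibilityAt_of_regularPrimeX9R1 (hS : Schneider1985_order_charGenerator)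
    (hex : exists_isCanonical) (hBCS : burungale_castella_skinner_charIdeal_eq_padicLFunction)
    (hmodP : nonempty_modularParametrizationData) (hC : RegularPrimeX9R1) (hX9 : ClassX9 W p)
    (hr : W.analyticRank = 1) (hlam : HasLambdaAnAt W p 1) : KatoDivisibilityAt W p :=
  katoDivisibilityAt_of_regularPrimeAt hS hex hBCS hmodP hX9 (hC W p hX9 hr hlam)

/-- **An X9 pair with MATCH and `p ∤ #Ш(E)[p^∞]` satisfies the crux AT THE PAIR** (the λ-free glue).
[cite: SteinWuthrich2013, §6.1 Thm. 6.1 (p. 20), §8] [cite: BurungaleCastellaSkinner2025, Thm. 1.1.2 (a)] -/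
theorem katoDivisibilityAt_of_heightLValueMatchAt (hS : Schneider1985_order_charGenerator)
    (hex : exists_isCanonical) (hBCS : burungale_castella_skinner_charIdeal_eq_padicLFunction)
    (hmodP : nonempty_modularParametrizationData) (hX9 : ClassX9 W p) (hM : HeightLValueMatchAt W p)
    (hsha : ¬ p ∣ Nat.card (AddCommGroup.primaryComponent W.sha p)) : KatoDivisibilityAt W p := by
  obtain ⟨-, hp, hgood, hord, hirr, -⟩ := id hX9
  exact hM.katoDivisibilityAt hS hex hBCS hmodP hp hgood hord hirr hsha

/-- desc-C6 feeds the crux node on its rows (rank 1, `p ∤ #Ш[p^∞]`). [cite: SteinWuthrich2013, §6.1 (p. 20)] -/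
theorem katoDivisibilityAt_of_matchX9R1 (hS : Schneider1985_order_charGenerator)
    (hex : exists_isCanonical) (hBCS : burungale_castella_skinner_charIdeal_eq_padicLFunction)
    (hmodP : nonempty_modularParametrizationData) (hC : MatchX9R1) (hX9 : ClassX9 W p)
    (hr : W.analyticRank = 1) (hsha : ¬ p ∣ Nat.card (AddCommGroup.primaryComponent W.sha p)) :
    KatoDivisibilityAt W p :=
  katoDivisibilityAt_of_heightLValueMatchAt hS hex hBCS hmodP hX9 (hC W p hX9 hr hsha) hsha

/-- **MATCH with the DESCENT certificate as Ш-gate ⟹ the crux AT THE PAIR** (rank-generic).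
[cite: SteinWuthrich2013, §6.1 Thm. 6.1 (p. 20)] [cite: Miller2011LMS, §6 Example 6.4] -/
theorem katoDivisibilityAt_of_heightLValueMatchAt_of_shaPTorsionFreeAt
    (hS : Schneider1985_order_charGenerator) (hex : exists_isCanonical)
    (hBCS : burungale_castella_skinner_charIdeal_eq_padicLFunction)
    (hmodP : nonempty_modularParametrizationData) (hX9 : ClassX9 W p) (hM : HeightLValueMatchAt W p)
    (hdesc : ShaPTorsionFreeAt W p) : KatoDivisibilityAt W p :=
  katoDivisibilityAt_of_heightLValueMatchAt hS hex hBCS hmodP hX9 hM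
    (not_dvd_natCard_primaryComponent_sha_of_shaPTorsionFreeAt hdesc)

/-- desc-C7 feeds the crux node on its rows (Mordell–Weil rank 0, `Ш[p] = 0` by descent).
[cite: Miller2011LMS, §6–§7] [cite: SteinWuthrich2013, §6.1 (p. 20)] -/
theorem katoDivisibilityAt_of_matchX9R0 (hS : Schneider1985_order_charGenerator)
    (hex : exists_isCanonical) (hBCS : burungale_castella_skinner_charIdeal_eq_padicLFunction)
    (hmodP : nonempty_modularParametrizationData) (hC : MatchX9R0) (hX9 : ClassX9 W p)
    (hr : W.mordellWeilRank = 0) (hdesc : ShaPTorsionFreeAt W p) : KatoDivisibilityAt W p :=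
  katoDivisibilityAt_of_heightLValueMatchAt_of_shaPTorsionFreeAt hS hex hBCS hmodP hX9 (hC W p hX9 hr hdesc)
    hdesc

/-- desc-C7′ feeds the crux node on its rows (Mordell–Weil rank `≤ 1`, `Ш[p] = 0` by descent).
[cite: Miller2011LMS, §6–§7] [cite: SteinWuthrich2013, §6.1 (p. 20)] -/
theorem katoDivisibilityAt_of_descentMatchX9 (hS : Schneider1985_order_charGenerator)
    (hex : exists_isCanonical) (hBCS : burungale_castella_skinner_charIdeal_eq_padicLFunction)
    (hmodP : nonempty_modularParametrizationData) (hC : DescentMatchX9) (hX9 : ClassX9 W p)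
    (hr : W.mordellWeilRank ≤ 1) (hdesc : ShaPTorsionFreeAt W p) : KatoDivisibilityAt W p :=
  katoDivisibilityAt_of_heightLValueMatchAt_of_shaPTorsionFreeAt hS hex hBCS hmodP hX9 (hC W p hX9 hr hdesc)
    hdesc

end PerPair

/-! ## §3 Class-wide reductions: the criteria reduce the node `KatoDivisibilityOnClassX9` to the uncertified pairs -/

/-- **desc-C7′ reduces the node to the X9 pairs without a clean descent**: if every X9 pair either has
Mordell–Weil rank `≤ 1` with a `p`-descent certifying `Ш[p] = 0`, or satisfies Kato divisibility at the pair
by some other road (`hcover`, DATA), then `KatoDivisibilityOnClassX9`.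
[cite: SteinWuthrich2013, §6.1 Thm. 6.1 (p. 20)] [cite: Miller2011LMS, §6–§7] -/
theorem katoDivisibilityOnClassX9_of_descentMatchX9_of_cover (hS : Schneider1985_order_charGenerator)
    (hex : exists_isCanonical) (hBCS : burungale_castella_skinner_charIdeal_eq_padicLFunction)
    (hmodP : nonempty_modularParametrizationData) (hC : DescentMatchX9)
    (hcover : ∀ (W : WeierstrassCurve ℚ) [W.IsElliptic] [W.IsGloballyMinimal] (p : ℕ) [Fact p.Prime],
      ClassX9 W p → (W.mordellWeilRank ≤ 1 ∧ ShaPTorsionFreeAt W p) ∨ KatoDivisibilityAt W p) :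
    KatoDivisibilityOnClassX9 := by
  intro W _ _ p _ κ γ N _ f hX9 hκ hγ hγ' hf D
  have hK : KatoDivisibilityAt W p := by
    rcases hcover W p hX9 with ⟨hr, hdesc⟩ | hK
    · exact katoDivisibilityAt_of_descentMatchX9 hS hex hBCS hmodP hC hX9 hr hdesc
    · exact hK
  exact hK κ γ f hκ hγ hγ' hf D

/-- **desc-C6 (rank 1) and desc-C7 (rank 0) together reduce the node to the pairs certified by neither**:
`hcover` = every X9 pair is of analytic rank 1 with `p ∤ #Ш[p^∞]`, or of Mordell–Weil rank 0 with a clean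
`p`-descent, or satisfies Kato divisibility otherwise. [cite: SteinWuthrich2013, §6.1 Thm. 6.1 (p. 20)] [cite: Miller2011LMS, §6–§7] -/
theorem katoDivisibilityOnClassX9_of_matchCriteria_of_cover (hS : Schneider1985_order_charGenerator)
    (hex : exists_isCanonical) (hBCS : burungale_castella_skinner_charIdeal_eq_padicLFunction)
    (hmodP : nonempty_modularParametrizationData) (hC1 : MatchX9R1) (hC0 : MatchX9R0)
    (hcover : ∀ (W : WeierstrassCurve ℚ) [W.IsElliptic] [W.IsGloballyMinimal] (p : ℕ) [Fact p.Prime],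
      ClassX9 W p →
        (W.analyticRank = 1 ∧ ¬ p ∣ Nat.card (AddCommGroup.primaryComponent W.sha p)) ∨
        (W.mordellWeilRank = 0 ∧ ShaPTorsionFreeAt W p) ∨ KatoDivisibilityAt W p) :
    KatoDivisibilityOnClassX9 := by
  intro W _ _ p _ κ γ N _ f hX9 hκ hγ hγ' hf D
  have hK : KatoDivisibilityAt W p := by
    rcases hcover W p hX9 with ⟨hr, hsha⟩ | ⟨hr, hdesc⟩ | hK
    · exact katoDivisibilityAt_of_matchX9R1 hS hex hBCS hmodP hC1 hX9 hr hsha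
    · exact katoDivisibilityAt_of_matchX9R0 hS hex hBCS hmodP hC0 hX9 hr hdesc
    · exact hK
  exact hK κ γ f hκ hγ hγ' hf D

/-- **desc-C5 reduces the node to the rank-1 X9 pairs off the simple-zero locus and the other pairs**:
`hcover` = every X9 pair is of analytic rank 1 with `λ(𝓛_p(E)) = 1`, or satisfies Kato divisibility
otherwise. [cite: SteinWuthrich2013, §6.1 Thm. 6.1 and the paragraph after it (p. 20)] [cite: GreenbergLNM1716, §1 Conj. 1.11] -/
theorem katoDivisibilityOnClassX9_of_regularPrimeX9R1_of_cover (hS : Schneider1985_order_charGenerator)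
    (hex : exists_isCanonical) (hBCS : burungale_castella_skinner_charIdeal_eq_padicLFunction)
    (hmodP : nonempty_modularParametrizationData) (hC : RegularPrimeX9R1)
    (hcover : ∀ (W : WeierstrassCurve ℚ) [W.IsElliptic] [W.IsGloballyMinimal] (p : ℕ) [Fact p.Prime],
      ClassX9 W p → (W.analyticRank = 1 ∧ HasLambdaAnAt W p 1) ∨ KatoDivisibilityAt W p) :
    KatoDivisibilityOnClassX9 := by
  intro W _ _ p _ κ γ N _ f hX9 hκ hγ hγ' hf D
  have hK : KatoDivisibilityAt W p := by
    rcases hcover W p hX9 with ⟨hr, hlam⟩ | hK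
    · exact katoDivisibilityAt_of_regularPrimeX9R1 hS hex hBCS hmodP hC hX9 hr hlam
    · exact hK
  exact hK κ γ f hκ hγ hγ' hf D

end Summit.BirchSwinnertonDyer.Rank1Residual.SmallImageMu

end
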